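import Summits.QuantumFields.BalabanUV.Beta.GAN24.EffectiveFormLocalisation

/-!
# `BalabanUV.Beta.GAN24.FluctuationCovarianceLocalisation` — binder row G-an2-4 ∕ (CONV-C), route R6 «VALUES, NOT DERIVATIVES», PART 106:
# S2′(h), THIRD BLOCK — THE FLUCTUATION COVARIANCE `𝒢 = flucCov H Q` IS AS LOCALISED AS THE SOFT RESOLVENT.  With PART 105 this completes the
# statement for ALL THREE BLOCKS of the bordered inverse `(kkt H Q)⁻¹ = [[𝒢, ℋ],[ℋᵀ, −𝒮]]` — an1's `M_k⁻¹ = [[Γ, Ξᵀ],[Ξ, −Σ]]`, i.e. the three (CONV-C)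
# constituents «fluctuation covariance `C^{(k)}`, minimiser `H_k`, effective form `Δ^{(k)}`» at ANY background (ROUTES-GAN24 §0 (0.2) v4 note):
# their k-uniform DECAY HALF reduces to ONE fine-lattice letter, the (3.42)-SHAPE entry decay of `K⁻¹ = (H + Qᵀ(a•1)Q)⁻¹` (Bałaban's `G_k = Δ_a⁻¹`),
# plus the upper bound `Λ` and the block locality of `Q`
# (unit b2b-balaban-gan24-p3, gen 50; v1)

NOT IN PRINT; OUR PROOF (for the ROUTE; [folklore] finite-dimensional linear algebra BY NAME: `CompositionSingular.blocks_eq_of_reg` (`𝒢 = K⁻¹ − ℋ·Q·K⁻¹`,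
[B9] (3.126) pattern `constrProp`) and PART 105's `abs_minOp_le`).  HONEST FRAMING (cell contract, verbatim): «discharging `BetaPertH` makes Bałaban's UV
stability UNCONDITIONAL — a real constructive-QFT result; it is NOT the continuum limit and NOT the Clay problem.»  HONEST DEPENDENCY (verbatim): «continuum YM
on T⁴ ⇐ BetaPertH ∧ nine spine estimates (0/9 proved); BetaPertH ⇐ (D1) ∧ (D4) ∧ CAP+tail; G-an2-4 gates asym, D1 and NE2/3/4.»

WHAT THIS FILE PROVES (0 sorry, 0 `def`, nothing cited; PART 105's letters: unit index `c` with pseudo-distance `ρ` and profile `Kf`, fine index `ν` with a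
fine gauge `D : ν → ν → ℝ` and a fine-to-unit gauge `σ : ν → c → ℝ`, regularised form `K = H + Qᵀ(a•1)Q`):
* §1 `mul_inv_apply_eq` (`(QK⁻¹)(b,x′) = (K⁻¹Qᵀ)(x′,b)` for symmetric `K`), **`flucCov_apply_eq`** — under `K` coercive and the upper bound:
  `𝒢(x,x′) = K⁻¹(x,x′) − Σ_b ℋ(x,b)·(K⁻¹Qᵀ)(x′,b)` (`blocks_eq_of_reg`: `𝒢 = constrProp K Q = K⁻¹ − ℋQK⁻¹`).
* §2 `sum_exp_fine_le`: `D(x,x′) ≤ σ(x,b) + σ(x′,b)` for all `b` and the fine-to-unit profile `Σ_b e^{−sσ(x,b)} ≤ Kσ(s)` ⟹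
  `Σ_b e^{−sσ(x,b)}e^{−sσ(x′,b)} ≤ Kσ(s∕2)·e^{−(s∕2)D(x,x′)}`.
* §3 **`abs_flucCov_sub_inv_le`** — THE END: under PART 105 §3's hypotheses plus §2's two letters,
  `|𝒢(x,x′) − K⁻¹(x,x′)| ≤ 2(Λ+a)·c₁²·Kf(m∕2)·Kσ(m∕4)·e^{−(m∕4)D(x,x′)}`, `m = min δ₁ (rate Kf (Λ+a)⁻¹ c₀ δ₀)`; and **`abs_flucCov_le`**: with the soft
  letter itself `|K⁻¹(x,x′)| ≤ Ce^{−δD(x,x′)}` (`D ≥ 0`), `|𝒢(x,x′)| ≤ (C + 2(Λ+a)c₁²Kf(m∕2)Kσ(m∕4))·e^{−(min δ (m∕4))·D(x,x′)}` — constants independent of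
  the fine index set (k- and volume-uniform).
WHAT IT DOES NOT DO: as PART 105 (no instantiation of the soft letter for Bałaban's `G_k(U)` — [B9] Thm 3.1, printed; no lattice chosen; RATE half of (CONV-C)
untouched).  SUPPLIER work on route C-R6° (rank 2, REDUCTION); no consumer of record; NEVER «G-an2-4 closed»; NOT (CONV-C), NOT D1, NOT `BetaPertH`, NOT continuum,
NOT Clay.  Records: `HOME/b2b-balaban-gan24-p3/gen50/README.md`.
-/

noncomputable section

open scoped BigOperators Matrix
open Finset Matrix
open Literature.MathematicalPhysics.QuantumFieldTheory.Balaban1983to89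
open Literature.MathematicalPhysics.QuantumFieldTheory.Balaban1983to89.B4Sect5Torus (IsPseudoDist SumBound rate rate_pos)
open Literature.MathematicalPhysics.QuantumFieldTheory.Balaban1983to89.Beta.Composition (kkt blockProp)
open Literature.MathematicalPhysics.QuantumFieldTheory.Balaban1983to89.Beta.CompositionSingular (effForm minOp flucCov blocks_eq_of_reg)
open Summit.QuantumFields.BalabanUV.Beta.GAN24.EffectiveFormLocalisation (transpose_reg blockProp_coercive_of_ub isUnit_det_of_coercive
  isUnit_det_of_coercive_fine abs_minOp_le)

namespace Summit.QuantumFields.BalabanUV.Beta.GAN24.FluctuationCovarianceLocalisation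

variable {c ν : Type*} [Fintype c] [Fintype ν] [DecidableEq c] [DecidableEq ν]
variable {H : Matrix ν ν ℝ} {Q : Matrix c ν ℝ} {a : ℝ}

/-! ## §1 The fluctuation covariance in terms of the soft resolvent and the hard minimiser -/

omit [Fintype c] [DecidableEq c] in
/-- `(QK⁻¹)(b,x′) = (K⁻¹Qᵀ)(x′,b)` for symmetric `K` (`K⁻¹ᵀ = Kᵀ⁻¹`). [folklore] -/
theorem mul_inv_apply_eq {K : Matrix ν ν ℝ} (hK : Kᵀ = K) (b : c) (x' : ν) : (Q * K⁻¹) b x' = (K⁻¹ * Qᵀ) x' b := by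
  rw [← transpose_apply (Q * K⁻¹) x' b, transpose_mul, transpose_nonsing_inv, hK]

/-- **`flucCov_apply_eq` — THE FLUCTUATION COVARIANCE FROM THE BORDERED INVERSE's REGULARISED READING** [our proof; `blocks_eq_of_reg` BY NAME]: `H` symmetric
with nonnegative form, `a > 0`, `K = H + Qᵀ(a•1)Q` coercive, the upper bound in trial form ⟹
`𝒢(x,x′) = K⁻¹(x,x′) − Σ_b ℋ(x,b)·(K⁻¹Qᵀ)(x′,b)` (`𝒢 = flucCov H Q`, `ℋ = minOp H Q`; [B9] (3.126) pattern `𝒢 = G − ℋQG`). -/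
theorem flucCov_apply_eq (hH : Hᵀ = H) (hpsd : ∀ z : ν → ℝ, 0 ≤ z ⬝ᵥ (H *ᵥ z)) (ha : 0 < a) {γ : ℝ} (hγ : 0 < γ)
    (hK : QGQInverse.Coercive (H + Qᵀ * (a • (1 : Matrix c c ℝ)) * Q) γ) {Λ : ℝ} (hΛ : 0 ≤ Λ)
    (hUB : ∀ B : c → ℝ, ∃ u : ν → ℝ, Q *ᵥ u = B ∧ u ⬝ᵥ (H *ᵥ u) ≤ Λ * (B ⬝ᵥ B)) (x x' : ν) :
    flucCov H Q x x' = (H + Qᵀ * (a • (1 : Matrix c c ℝ)) * Q)⁻¹ x x' -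
      ∑ b, minOp H Q x b * ((H + Qᵀ * (a • (1 : Matrix c c ℝ)) * Q)⁻¹ * Qᵀ) x' b := by
  set K : Matrix ν ν ℝ := H + Qᵀ * (a • (1 : Matrix c c ℝ)) * Q with hKdef
  have hΛa : 0 < Λ + a := by linarith
  have hPco : QGQInverse.Coercive (blockProp K Q) (Λ + a)⁻¹ := blockProp_coercive_of_ub hH hpsd ha hγ hK hΛ hUB
  have hKdet : IsUnit K.det := isUnit_det_of_coercive_fine hγ hK
  have hPdet : IsUnit (blockProp K Q).det := isUnit_det_of_coercive (inv_pos.mpr hΛa) hPco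
  obtain ⟨-, hM, hC⟩ := blocks_eq_of_reg H Q (a • (1 : Matrix c c ℝ)) hKdet hPdet
  have hG : flucCov H Q = K⁻¹ - minOp H Q * Q * K⁻¹ := by
    rw [hC, Beta.Envelope.constrProp, Beta.Envelope.minMap, ← hM]
  rw [hG, Matrix.sub_apply, Matrix.mul_assoc, Matrix.mul_apply]
  congr 1
  exact Finset.sum_congr rfl fun b _ => by rw [mul_inv_apply_eq (transpose_reg hH a)]

/-! ## §2 The fine–unit–fine convolution -/

omit [Fintype ν] [DecidableEq c] [DecidableEq ν] in
/-- **FINE–UNIT–FINE CONVOLUTION**: `0 ≤ σ`, `D(x,x′) ≤ σ(x,b) + σ(x′,b)` for every `b`, the fine-to-unit profile `Σ_b e^{−sσ(x,b)} ≤ Kσ(s)` (`s > 0`) ⟹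
`Σ_b e^{−sσ(x,b)}·e^{−sσ(x′,b)} ≤ Kσ(s∕2)·e^{−(s∕2)D(x,x′)}`. [folklore] -/
theorem sum_exp_fine_le {σ : ν → c → ℝ} {D : ν → ν → ℝ} {Kσ : ℝ → ℝ} (hσ0 : ∀ x b, 0 ≤ σ x b)
    (hDσ : ∀ x x' b, D x x' ≤ σ x b + σ x' b) (hKσ : ∀ s : ℝ, 0 < s → ∀ x : ν, ∑ b, Real.exp (-(s * σ x b)) ≤ Kσ s)
    {s : ℝ} (hs : 0 < s) (x x' : ν) :
    ∑ b, Real.exp (-(s * σ x b)) * Real.exp (-(s * σ x' b)) ≤ Kσ (s / 2) * Real.exp (-(s / 2 * D x x')) := by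
  have hpt : ∀ b, Real.exp (-(s * σ x b)) * Real.exp (-(s * σ x' b)) ≤ Real.exp (-(s / 2 * D x x')) * Real.exp (-(s / 2 * σ x b)) :=
    fun b => by
      rw [← Real.exp_add, ← Real.exp_add]
      apply Real.exp_le_exp.mpr
      have h1 := hDσ x x' b
      have h2 := hσ0 x b
      have h3 := hσ0 x' b
      nlinarith
  calc ∑ b, Real.exp (-(s * σ x b)) * Real.exp (-(s * σ x' b))
      ≤ ∑ b, Real.exp (-(s / 2 * D x x')) * Real.exp (-(s / 2 * σ x b)) := Finset.sum_le_sum fun b _ => hpt b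
    _ = Real.exp (-(s / 2 * D x x')) * ∑ b, Real.exp (-(s / 2 * σ x b)) := by rw [Finset.mul_sum]
    _ ≤ Real.exp (-(s / 2 * D x x')) * Kσ (s / 2) := mul_le_mul_of_nonneg_left (hKσ _ (by linarith) x) (Real.exp_pos _).le
    _ = Kσ (s / 2) * Real.exp (-(s / 2 * D x x')) := mul_comm _ _

/-! ## §3 The fluctuation covariance is localised -/

section End

variable {ρ : c → c → ℝ} {Kf Kσ : ℝ → ℝ} {σ : ν → c → ℝ} {D : ν → ν → ℝ}

/-- **`abs_flucCov_sub_inv_le` — THE FLUCTUATION COVARIANCE MINUS THE SOFT RESOLVENT IS LOCALISED** [our proof; §1 + PART 105 `abs_minOp_le` BY NAME]: under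
PART 105 §3's hypotheses (`H` PSD, `a > 0`, `K` coercive, upper bound `Λ`, unit-lattice decay of `QK⁻¹Qᵀ` at `(c₀, δ₀)` in the pseudo-distance `ρ` with profile
`Kf`, fine-to-unit gauge `σ ≥ 0` compatible with `ρ`, decay of `K⁻¹Qᵀ` at `(c₁, δ₁)` in `σ`) plus the fine–unit–fine compatibility `D(x,x′) ≤ σ(x,b) + σ(x′,b)` and
the fine-to-unit profile `Kσ`: `|𝒢(x,x′) − K⁻¹(x,x′)| ≤ 2(Λ+a)·c₁²·Kf(m∕2)·Kσ(m∕4)·e^{−(m∕4)D(x,x′)}`, `m = min δ₁ (rate Kf (Λ+a)⁻¹ c₀ δ₀)`. -/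
theorem abs_flucCov_sub_inv_le (hKf : ∀ r, 0 < r → 0 ≤ Kf r) (hρ : IsPseudoDist ρ) (hS : SumBound ρ Kf)
    (hH : Hᵀ = H) (hpsd : ∀ z : ν → ℝ, 0 ≤ z ⬝ᵥ (H *ᵥ z)) (ha : 0 < a) {γ : ℝ} (hγ : 0 < γ)
    (hK : QGQInverse.Coercive (H + Qᵀ * (a • (1 : Matrix c c ℝ)) * Q) γ) {Λ : ℝ} (hΛ : 0 ≤ Λ)
    (hUB : ∀ B : c → ℝ, ∃ u : ν → ℝ, Q *ᵥ u = B ∧ u ⬝ᵥ (H *ᵥ u) ≤ Λ * (B ⬝ᵥ B)) {c₀ δ₀ : ℝ} (hc₀ : 0 ≤ c₀) (hδ₀ : 0 < δ₀)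
    (hP : ∀ b b', |blockProp (H + Qᵀ * (a • (1 : Matrix c c ℝ)) * Q) Q b b'| ≤ c₀ * Real.exp (-(δ₀ * ρ b b')))
    (hσ0 : ∀ x b, 0 ≤ σ x b) (hσρ : ∀ x b b', σ x b ≤ σ x b' + ρ b' b) {c₁ δ₁ : ℝ} (hc₁ : 0 ≤ c₁) (hδ₁ : 0 < δ₁)
    (hKQ : ∀ x b', |((H + Qᵀ * (a • (1 : Matrix c c ℝ)) * Q)⁻¹ * Qᵀ) x b'| ≤ c₁ * Real.exp (-(δ₁ * σ x b')))
    (hDσ : ∀ x x' b, D x x' ≤ σ x b + σ x' b) (hKσ : ∀ s : ℝ, 0 < s → ∀ x : ν, ∑ b, Real.exp (-(s * σ x b)) ≤ Kσ s) (x x' : ν) :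
    |flucCov H Q x x' - ((H + Qᵀ * (a • (1 : Matrix c c ℝ)) * Q)⁻¹) x x'| ≤
      2 * (Λ + a) * c₁ ^ 2 * Kf (min δ₁ (rate Kf (Λ + a)⁻¹ c₀ δ₀) / 2) * Kσ (min δ₁ (rate Kf (Λ + a)⁻¹ c₀ δ₀) / 4) *
        Real.exp (-(min δ₁ (rate Kf (Λ + a)⁻¹ c₀ δ₀) / 4 * D x x')) := by
  set K : Matrix ν ν ℝ := H + Qᵀ * (a • (1 : Matrix c c ℝ)) * Q with hKdef
  set r : ℝ := rate Kf (Λ + a)⁻¹ c₀ δ₀ with hr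
  have hΛa : 0 < Λ + a := by linarith
  have hrpos : 0 < r := rate_pos hKf (inv_pos.mpr hΛa) hc₀ hδ₀
  set m : ℝ := min δ₁ r with hm
  have hmpos : 0 < m := lt_min hδ₁ hrpos
  have hmδ : m ≤ δ₁ := min_le_left _ _
  have hKf0 : 0 ≤ Kf (m / 2) := hKf _ (by linarith)
  -- the hard minimiser's columns (PART 105) and the soft letter `hKQ`, both at the common rate `m/2`
  have hcol : ∀ b, |minOp H Q x b| ≤ 2 * (Λ + a) * c₁ * Kf (m / 2) * Real.exp (-(m / 2 * σ x b)) := fun b =>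
    abs_minOp_le hKf hρ hS hH hpsd ha hγ hK hΛ hUB hc₀ hδ₀ hP hσ0 hσρ hc₁ hδ₁ hKQ x b
  have hrow : ∀ b, |(K⁻¹ * Qᵀ) x' b| ≤ c₁ * Real.exp (-(m / 2 * σ x' b)) := fun b => by
    refine (hKQ x' b).trans (mul_le_mul_of_nonneg_left (Real.exp_le_exp.mpr ?_) hc₁)
    have := hσ0 x' b
    nlinarith
  rw [flucCov_apply_eq hH hpsd ha hγ hK hΛ hUB x x', sub_sub_cancel_left, abs_neg]
  calc |∑ b, minOp H Q x b * (K⁻¹ * Qᵀ) x' b|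
      ≤ ∑ b, |minOp H Q x b * (K⁻¹ * Qᵀ) x' b| := Finset.abs_sum_le_sum_abs _ _
    _ ≤ ∑ b, 2 * (Λ + a) * c₁ * Kf (m / 2) * Real.exp (-(m / 2 * σ x b)) * (c₁ * Real.exp (-(m / 2 * σ x' b))) :=
        Finset.sum_le_sum fun b _ => by
          rw [abs_mul]
          exact mul_le_mul (hcol b) (hrow b) (abs_nonneg _) (by positivity)
    _ = 2 * (Λ + a) * c₁ ^ 2 * Kf (m / 2) * ∑ b, Real.exp (-(m / 2 * σ x b)) * Real.exp (-(m / 2 * σ x' b)) := by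
        rw [Finset.mul_sum]; exact Finset.sum_congr rfl fun b _ => by ring
    _ ≤ 2 * (Λ + a) * c₁ ^ 2 * Kf (m / 2) * (Kσ (m / 2 / 2) * Real.exp (-(m / 2 / 2 * D x x'))) :=
        mul_le_mul_of_nonneg_left (sum_exp_fine_le hσ0 hDσ hKσ (by linarith) x x') (by positivity)
    _ = 2 * (Λ + a) * c₁ ^ 2 * Kf (m / 2) * Kσ (m / 4) * Real.exp (-(m / 4 * D x x')) := by
        rw [div_div, show (2 : ℝ) * 2 = 4 by norm_num]; ring

/-- **`abs_flucCov_le` — THE FLUCTUATION COVARIANCE IS AS LOCALISED AS THE SOFT RESOLVENT** [our proof]: adding the soft letter itself,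
`|K⁻¹(x,x′)| ≤ Ce^{−δD(x,x′)}` with `C ≥ 0`, `D ≥ 0`: `|𝒢(x,x′)| ≤ (C + 2(Λ+a)c₁²Kf(m∕2)Kσ(m∕4))·e^{−min δ (m∕4) · D(x,x′)}`,
`m = min δ₁ (rate Kf (Λ+a)⁻¹ c₀ δ₀)` — the k-uniform DECAY HALF of (CONV-C) for the fluctuation-covariance constituent, reduced to the soft resolvent's decay +
the upper bound (with PART 105: all three blocks `𝒢, ℋ, 𝒮` of the bordered inverse). -/
theorem abs_flucCov_le (hKf : ∀ r, 0 < r → 0 ≤ Kf r) (hρ : IsPseudoDist ρ) (hS : SumBound ρ Kf)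
    (hH : Hᵀ = H) (hpsd : ∀ z : ν → ℝ, 0 ≤ z ⬝ᵥ (H *ᵥ z)) (ha : 0 < a) {γ : ℝ} (hγ : 0 < γ)
    (hK : QGQInverse.Coercive (H + Qᵀ * (a • (1 : Matrix c c ℝ)) * Q) γ) {Λ : ℝ} (hΛ : 0 ≤ Λ)
    (hUB : ∀ B : c → ℝ, ∃ u : ν → ℝ, Q *ᵥ u = B ∧ u ⬝ᵥ (H *ᵥ u) ≤ Λ * (B ⬝ᵥ B)) {c₀ δ₀ : ℝ} (hc₀ : 0 ≤ c₀) (hδ₀ : 0 < δ₀)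
    (hP : ∀ b b', |blockProp (H + Qᵀ * (a • (1 : Matrix c c ℝ)) * Q) Q b b'| ≤ c₀ * Real.exp (-(δ₀ * ρ b b')))
    (hσ0 : ∀ x b, 0 ≤ σ x b) (hσρ : ∀ x b b', σ x b ≤ σ x b' + ρ b' b) {c₁ δ₁ : ℝ} (hc₁ : 0 ≤ c₁) (hδ₁ : 0 < δ₁)
    (hKQ : ∀ x b', |((H + Qᵀ * (a • (1 : Matrix c c ℝ)) * Q)⁻¹ * Qᵀ) x b'| ≤ c₁ * Real.exp (-(δ₁ * σ x b')))
    (hDσ : ∀ x x' b, D x x' ≤ σ x b + σ x' b) (hKσ : ∀ s : ℝ, 0 < s → ∀ x : ν, ∑ b, Real.exp (-(s * σ x b)) ≤ Kσ s)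
    (hD0 : ∀ x x', 0 ≤ D x x') {C δ : ℝ} (hC : 0 ≤ C)
    (hG : ∀ x x', |((H + Qᵀ * (a • (1 : Matrix c c ℝ)) * Q)⁻¹) x x'| ≤ C * Real.exp (-(δ * D x x'))) (x x' : ν) :
    |flucCov H Q x x'| ≤
      (C + 2 * (Λ + a) * c₁ ^ 2 * Kf (min δ₁ (rate Kf (Λ + a)⁻¹ c₀ δ₀) / 2) * Kσ (min δ₁ (rate Kf (Λ + a)⁻¹ c₀ δ₀) / 4)) *
        Real.exp (-(min δ (min δ₁ (rate Kf (Λ + a)⁻¹ c₀ δ₀) / 4) * D x x')) := by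
  set K : Matrix ν ν ℝ := H + Qᵀ * (a • (1 : Matrix c c ℝ)) * Q with hKdef
  set m : ℝ := min δ₁ (rate Kf (Λ + a)⁻¹ c₀ δ₀) with hm
  set A : ℝ := 2 * (Λ + a) * c₁ ^ 2 * Kf (m / 2) * Kσ (m / 4) with hA
  set t : ℝ := min δ (m / 4) with ht
  have hdiff := abs_flucCov_sub_inv_le hKf hρ hS hH hpsd ha hγ hK hΛ hUB hc₀ hδ₀ hP hσ0 hσρ hc₁ hδ₁ hKQ hDσ hKσ x x'
  have hΛa : 0 < Λ + a := by linarith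
  have hmpos : 0 < m := lt_min hδ₁ (rate_pos hKf (inv_pos.mpr hΛa) hc₀ hδ₀)
  -- both exponentials are dominated by the one at the smaller rate `t`
  have hD := hD0 x x'
  have e1 : Real.exp (-(δ * D x x')) ≤ Real.exp (-(t * D x x')) :=
    Real.exp_le_exp.mpr (by nlinarith [min_le_left δ (m / 4)])
  have e2 : Real.exp (-(m / 4 * D x x')) ≤ Real.exp (-(t * D x x')) :=
    Real.exp_le_exp.mpr (by nlinarith [min_le_right δ (m / 4)])
  -- `A ≥ 0`: it dominates an absolute value times a positive exponential
  have hA0 : 0 ≤ A := by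
    have h1 : 0 ≤ A * Real.exp (-(m / 4 * D x x')) := (abs_nonneg _).trans hdiff
    exact nonneg_of_mul_nonneg_left (by rwa [mul_comm] at h1) (Real.exp_pos _)
  have hsplit : flucCov H Q x x' = (flucCov H Q x x' - K⁻¹ x x') + K⁻¹ x x' := by ring
  rw [hsplit]
  calc |flucCov H Q x x' - K⁻¹ x x' + K⁻¹ x x'| ≤ |flucCov H Q x x' - K⁻¹ x x'| + |K⁻¹ x x'| := abs_add_le _ _
    _ ≤ A * Real.exp (-(m / 4 * D x x')) + C * Real.exp (-(δ * D x x')) := add_le_add hdiff (hG x x')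
    _ ≤ A * Real.exp (-(t * D x x')) + C * Real.exp (-(t * D x x')) :=
        add_le_add (mul_le_mul_of_nonneg_left e2 hA0) (mul_le_mul_of_nonneg_left e1 hC)
    _ = (C + A) * Real.exp (-(t * D x x')) := by ring

end End

end Summit.QuantumFields.BalabanUV.Beta.GAN24.FluctuationCovarianceLocalisation

end
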